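import Summits.PneNP.PneNP.Theorems.ExpanderLinearGeneratorsResSim
import Summits.PneNP.PneNP.Theorems.ExpanderLinearGeneratorsLightExpansion
import Summits.PneNP.PneNP.Theorems.ExpanderLinearGeneratorsLinearGeneratorResolutionSize

/-!
# PneNP / ExpanderLinearGenerators — the resolution-size rung at EVERY expansion scale when the
light variables carry the expansion

Route `PneNP/ExpanderLinearGenerators`, support for crux stmt-PneNP-11443. The tree's resolution
rung `linearGenerator_resolution_size_lower_bound` (Ben-Sasson–Wigderson size–width) needs
`δ < 1/2`; for `δ ≥ 1/2` the size–width relation is void and no resolution size lower bound for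
expanding `𝔽₂`-systems at scale `n^{1-δ}` is in print in general. For systems whose LIGHT parts
(variables of column weight `≤ 2`) carry the `(n^{1-δ}, 3ℓ/4)`-boundary expansion we get it for
ALL `0 < δ < 1`: a resolution refutation `ρ` of `sumEncoding 1 E` is first restricted to the
variables `< n` (foreign pivots become weakenings; clauses then have `≤ 2n` literals), then
simulated by a depth-`11` `textbookFrege` proof of size polynomial in `|ρ|` and `n`
(`ResSim.exists_proof_of_isResRefutation`; the number of rows is `≤ (ℓ+1) n^ℓ` because distinct
rows have distinct light parts), to which `LinGen.linearGeneratorDepthFregeHard_of_light_expansion`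
applies.

* `exists_restricted_refutation` — restriction of a refutation to the variables of the CNF;
* `card_rows_le_of_light_expansion` — `m ≤ (ℓ + 1) n^ℓ`;
* `resolution_size_of_light_expansion` — the rung: `|ρ| ≥ 2^{n^ε}` for `n ≥ N`, every `δ ∈ (0,1)`.

References: E. Ben-Sasson, A. Wigderson, J. ACM 48 (2001) (size–width, the `δ < 1/2` rung);
J. Krajíček, *Proof complexity* (CUP 2019), Cor. 13.4.6, Problem 19.4.5; N. Galesi, D. Itsykson,
A. Riazanov, A. Sofronova, APAL 174 (2023) (Tseitin: resolution bounds via bounded depth).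
-/

namespace Summit.PneNP.PneNP.Theorems.ResSim

open Filter Finset Literature.Computability.MetaComplexity
open Literature.Computability.MetaComplexity.TextbookFrege
open Literature.Computability.Complexity (PropForm Clause CNF Literal)
open Literature.Computability.Complexity.PropForm
open Literature.Computability.MetaComplexity.KrajicekRamsey (clauseOf)

/-! ### Restricting a refutation to the variables of the CNF -/

/-- **Restriction of a resolution refutation to the variables `< N`.** If every literal of `T` is
on a variable `< N`, a refutation of `T` can be replaced by one of the same length all of whose
clauses consist of literals on variables `< N` (hence have at most `2N` literals): intersect every
clause with these literals; steps on a pivot `≥ N` become weakenings. [folklore] -/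
theorem exists_restricted_refutation {T : CNF ℕ} {N : ℕ} (hT : ∀ c ∈ T, ∀ l ∈ c, l.1 < N)
    {ρ : List (ResLine ℕ)} (hρ : IsResRefutation T ρ) :
    ∃ ρ' : List (ResLine ℕ), IsResRefutation T ρ' ∧ ρ'.length = ρ.length ∧
      ∀ l ∈ ρ', l.clause.card ≤ 2 * N := by
  classical
  -- the restricted lines
  let f : ResLine ℕ → ResLine ℕ := fun l =>
    ⟨l.clause.filter fun x => x.1 < N,
      match l.rule with
      | .initial => .initial
      | .resolve i j v => if v < N then .resolve i j v else .weaken i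
      | .weaken i => .weaken i⟩
  refine ⟨ρ.map f, ⟨?_, ?_⟩, List.length_map _, ?_⟩
  · -- validity, line by line
    intro k hk
    rw [List.length_map] at hk
    have hv := hρ.1 k hk
    rw [List.getElem_map]
    have htake : (ρ.map f).take k = (ρ.take k).map f := List.map_take.symm
    set l := ρ[k] with hl
    unfold IsValidResLine at hv ⊢
    rw [htake]
    -- case analysis on the rule of `l`
    rcases hr : l.rule with _ | ⟨i, j, v⟩ | i
    · -- initial
      rw [hr] at hv
      simp only [f, hr]
      obtain ⟨c, hc, hcl⟩ := List.mem_map.1 hv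
      have : (l.clause.filter fun x => x.1 < N) = l.clause := by
        refine Finset.filter_true_of_mem fun x hx => ?_
        rw [← hcl, List.mem_toFinset] at hx
        exact hT c hc x hx
      rw [this]
      exact hv
    · -- resolve
      rw [hr] at hv
      obtain ⟨hi, hj, hvi, hvj, hE⟩ := hv
      have hi' : i < ((ρ.take k).map f).length := by rwa [List.length_map]
      have hj' : j < ((ρ.take k).map f).length := by rwa [List.length_map]
      by_cases hvN : v < N
      · simp only [f, hr, if_pos hvN]
        refine ⟨hi', hj', ?_, ?_, ?_⟩
        · rw [List.getElem_map]; exact Finset.mem_filter.2 ⟨hvi, hvN⟩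
        · rw [List.getElem_map]; exact Finset.mem_filter.2 ⟨hvj, hvN⟩
        · rw [List.getElem_map, List.getElem_map, hE]
          ext x
          simp only [Finset.mem_filter, Finset.mem_union, Finset.mem_erase]
          tauto
      · simp only [f, hr, if_neg hvN]
        refine ⟨hi', ?_⟩
        rw [List.getElem_map, hE]
        intro x hx
        simp only [Finset.mem_filter, Finset.mem_union, Finset.mem_erase] at hx ⊢
        refine ⟨Or.inl ⟨?_, hx.1⟩, hx.2⟩
        rintro rfl
        exact hvN hx.2
    · -- weaken
      rw [hr] at hv
      obtain ⟨hi, hsub⟩ := hv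
      have hi' : i < ((ρ.take k).map f).length := by rwa [List.length_map]
      simp only [f, hr]
      refine ⟨hi', ?_⟩
      rw [List.getElem_map]
      exact Finset.filter_subset_filter _ hsub
  · -- the empty clause survives
    obtain ⟨l, hl, hle⟩ := hρ.2
    exact ⟨f l, List.mem_map.2 ⟨l, hl, rfl⟩, by simp [f, hle]⟩
  · -- clause sizes
    intro l' hl'
    obtain ⟨l, -, rfl⟩ := List.mem_map.1 hl'
    calc (l.clause.filter fun x => x.1 < N).card
        ≤ ((Finset.range N) ×ˢ (Finset.univ : Finset Bool)).card :=
          Finset.card_le_card fun x hx => by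
            rw [Finset.mem_filter] at hx
            exact Finset.mem_product.2 ⟨Finset.mem_range.2 hx.2, Finset.mem_univ _⟩
      _ = 2 * N := by rw [Finset.card_product, Finset.card_range, Finset.card_univ,
          Fintype.card_bool, mul_comm]

/-! ### The number of rows under light expansion -/

/-- **Distinct rows have distinct light parts** when pairs of rows expand, so an `ℓ`-sparse system
whose light parts form an `(r, c)`-boundary expander with `r ≥ 2`, `c > 0` has at most
`(ℓ + 1) n^ℓ` rows. [folklore] -/
theorem card_rows_le_of_light_expansion {m n ℓ : ℕ} (E : Fin m → LinEqMod 2 n) {r c : ℝ}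
    (hr : 2 ≤ r) (hc : 0 < c) (hsparse : ∀ i, (E i).supp.card ≤ ℓ) (hn : 1 ≤ n)
    (hexp : IsBoundaryExpander
      (fun i => ((E i).supp.filter fun j =>
        (Finset.univ.filter fun i' => j ∈ (E i').supp).card ≤ 2).map Fin.valEmbedding) r c) :
    m ≤ (ℓ + 1) * n ^ ℓ := by
  classical
  set Lp : Fin m → Finset (Fin n) := fun i => (E i).supp.filter fun j =>
    (Finset.univ.filter fun i' => j ∈ (E i').supp).card ≤ 2 with hLp
  -- injectivity from expansion of pairs
  have hinj : Function.Injective Lp := by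
    intro i j hij
    by_contra hne
    have h2 : (({i, j} : Finset (Fin m)).card : ℝ) ≤ r := by
      rw [Finset.card_pair hne]; exact_mod_cast hr
    have h := hexp {i, j} h2
    have hb : boundary (fun i => (Lp i).map Fin.valEmbedding) {i, j} = ∅ := by
      refine Finset.eq_empty_of_forall_notMem fun x hx => ?_
      rw [mem_boundary] at hx
      obtain ⟨hcov, hdeg⟩ := hx
      unfold coverDegree at hdeg
      have : (({i, j} : Finset (Fin m)).filter fun t => x ∈ (Lp t).map Fin.valEmbedding) = {i, j} := by
        refine Finset.filter_true_of_mem fun t ht => ?_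
        simp only [Finset.mem_insert, Finset.mem_singleton] at ht
        obtain ⟨t₀, ht₀, hx₀⟩ := mem_cover.1 hcov
        simp only [Finset.mem_insert, Finset.mem_singleton] at ht₀
        rcases ht with rfl | rfl <;> rcases ht₀ with rfl | rfl
        · exact hx₀
        · rwa [hij]
        · rwa [← hij]
        · exact hx₀
      rw [this, Finset.card_pair hne] at hdeg
      exact absurd hdeg (by norm_num)
    have hcard : (({i, j} : Finset (Fin m)).card : ℝ) = 2 := by
      rw [Finset.card_pair hne]; norm_num
    rw [hcard] at h
    have : (boundary (fun i => (Lp i).map Fin.valEmbedding) {i, j}).card = 0 := by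
      rw [show (fun i => (Lp i).map Fin.valEmbedding) =
        (fun i => ((E i).supp.filter fun j =>
          (Finset.univ.filter fun i' => j ∈ (E i').supp).card ≤ 2).map Fin.valEmbedding) from rfl] at hb ⊢
      rw [hb]; rfl
    rw [this] at h
    simp at h
    linarith
  -- counting finsets of size `≤ ℓ`
  have himg : (Finset.univ.image Lp).card = m := by
    rw [Finset.card_image_of_injective _ hinj, Finset.card_univ, Fintype.card_fin]
  have hsub : Finset.univ.image Lp ⊆ (Finset.range (ℓ + 1)).biUnion
      fun k => Finset.powersetCard k (Finset.univ : Finset (Fin n)) := by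
    intro s hs
    obtain ⟨i, -, rfl⟩ := Finset.mem_image.1 hs
    refine Finset.mem_biUnion.2 ⟨(Lp i).card, Finset.mem_range.2 (Nat.lt_succ_of_le ?_),
      Finset.mem_powersetCard.2 ⟨Finset.subset_univ _, rfl⟩⟩
    exact (Finset.card_filter_le _ _).trans (hsparse i)
  have hcount : ((Finset.range (ℓ + 1)).biUnion
      fun k => Finset.powersetCard k (Finset.univ : Finset (Fin n))).card ≤ (ℓ + 1) * n ^ ℓ := by
    refine Finset.card_biUnion_le.trans ?_
    calc ∑ k ∈ Finset.range (ℓ + 1), (Finset.powersetCard k (Finset.univ : Finset (Fin n))).card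
        ≤ ∑ _k ∈ Finset.range (ℓ + 1), n ^ ℓ := Finset.sum_le_sum fun k hk => by
          rw [Finset.card_powersetCard, Finset.card_univ, Fintype.card_fin]
          have hk' : k ≤ ℓ := Nat.lt_succ_iff.1 (Finset.mem_range.1 hk)
          have h1 : (n.choose k : ℚ) ≤ (n : ℚ) ^ k / (Nat.factorial k) := Nat.choose_le_pow_div k n
          have h2 : (n : ℚ) ^ k / (Nat.factorial k) ≤ (n : ℚ) ^ k :=
            div_le_self (by positivity) (by exact_mod_cast Nat.one_le_iff_ne_zero.2 (Nat.factorial_ne_zero k))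
          have h3 : n.choose k ≤ n ^ k := by exact_mod_cast h1.trans h2
          exact h3.trans (Nat.pow_le_pow_right hn hk')
      _ = (ℓ + 1) * n ^ ℓ := by rw [Finset.sum_const, Finset.card_range, smul_eq_mul]
  calc m = (Finset.univ.image Lp).card := himg.symm
    _ ≤ _ := Finset.card_le_card hsub
    _ ≤ (ℓ + 1) * n ^ ℓ := hcount

/-! ### The rung -/

/-- Sizes of the XOR-CNF of an `ℓ`-sparse system with `m` rows: `|T| ≤ m 2^ℓ` clauses and
`|ofCNF T| ≤ m 2^ℓ (3ℓ+2) + 1`. [folklore] -/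
theorem sizes_sumEncoding_le {m n ℓ : ℕ} (E : Fin m → LinEqMod 2 n) (hsparse : ∀ i, (E i).supp.card ≤ ℓ) :
    (sumEncoding 1 E).length ≤ m * 2 ^ ℓ ∧
      (PropForm.ofCNF (sumEncoding 1 E)).size ≤ m * (2 ^ ℓ * (3 * ℓ + 2)) + 1 := by
  constructor
  · unfold sumEncoding
    rw [List.length_flatMap]
    have : ∀ x ∈ (List.finRange m).map (fun k => (equationCNF 1 (E k)).length), x ≤ 2 ^ ℓ := by
      intro x hx
      obtain ⟨k, -, rfl⟩ := List.mem_map.1 hx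
      exact (ColumnTwo.length_equationCNF_le (E k)).trans (Nat.pow_le_pow_right (by norm_num) (hsparse k))
    have h := List.sum_le_card_nsmul _ _ this
    rw [List.length_map, List.length_finRange, smul_eq_mul] at h
    exact h
  · rw [KrajicekRamsey.ofCNF_eq_conjList, size_conjList_eq_msum]
    have := LinGen.msum_sumEncoding_le E hsparse
    omega

/-- **The resolution-size rung at every scale, for light-expanding systems.** For `ℓ ≥ 1` and
`0 < δ < 1` there are `ε > 0` and `N` such that for `n ≥ N`: every `ℓ`-sparse unsolvable system
`E : Fin m → LinEqMod 2 n` whose light parts of the supports form an `(n^{1-δ}, 3ℓ/4)`-boundary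
expander (in particular every such system of column weight `≤ 2`) admits no resolution refutation
of `sumEncoding 1 E` with fewer than `2^{n^ε}` lines. (For `δ < 1/2` and all systems this is
`linearGenerator_resolution_size_lower_bound`; here `δ` is arbitrary.) Proof: restriction of the
refutation to the variables `< n`, the p-simulation by depth-`11` `textbookFrege`
(`exists_proof_of_isResRefutation`), the row count `m ≤ (ℓ+1) n^ℓ`, and
`LinGen.linearGeneratorDepthFregeHard_of_light_expansion` at depth `11`.
[Krajíček 2019, Cor. 13.4.6 / Problem 19.4.5; Ben-Sasson–Wigderson 2001; Galesi et al. 2023] -/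
theorem resolution_size_of_light_expansion :
    ∀ (ℓ : ℕ) (δ : ℝ), 1 ≤ ℓ → 0 < δ → δ < 1 → ∃ ε : ℝ, 0 < ε ∧ ∃ N : ℕ, ∀ n : ℕ, N ≤ n →
      ∀ (m : ℕ) (E : Fin m → LinEqMod 2 n),
      (∀ i, (E i).supp.card ≤ ℓ) →
      IsBoundaryExpander
        (fun i => ((E i).supp.filter fun j =>
          (Finset.univ.filter fun i' => j ∈ (E i').supp).card ≤ 2).map Fin.valEmbedding)
        ((n : ℝ) ^ (1 - δ)) (3 / 4 * ℓ) →
      ¬ SystemSat E Finset.univ →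
      ∀ ρ : List (ResLine ℕ), IsResRefutation (sumEncoding 1 E) ρ →
        (2 : ℝ) ^ ((n : ℝ) ^ ε) ≤ (ρ.length : ℝ) := by
  intro ℓ δ hℓ hδ hδ1
  obtain ⟨ε₀, hε₀, N₁, hN₁⟩ :=
    LinGen.linearGeneratorDepthFregeHard_of_light_expansion ℓ 11 δ hℓ hδ hδ1
  -- the polynomial: `K, LF ≤ Cℓ n^ℓ`, proof size `≤ (|ρ|+1) · Dℓ · n^{3ℓ}`
  obtain ⟨q, hq⟩ : ∃ q : ℕ, q = 2 ^ ℓ * (3 * ℓ + 3) := ⟨_, rfl⟩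
  obtain ⟨Cℓ, hCℓ⟩ : ∃ C : ℕ, C = 2 * (ℓ + 1) * q + 9 := ⟨_, rfl⟩
  obtain ⟨Dℓ, hDℓ⟩ : ∃ D : ℕ, D = 22800 * Cℓ ^ 3 := ⟨_, rfl⟩
  have hε2 : 0 < ε₀ / 2 := by positivity
  have e1 := Literature.Computability.Complexity.eventually_pow_lt_two_rpow_rpow (3 * ℓ + 1) hε2
  have e2 : ∀ᶠ n : ℕ in atTop, (3 : ℝ) ≤ (n : ℝ) ^ (ε₀ / 2) :=
    ((tendsto_rpow_atTop hε2).comp tendsto_natCast_atTop_atTop).eventually_ge_atTop 3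
  have e3 : ∀ᶠ n : ℕ in atTop, (2 : ℝ) ≤ (n : ℝ) ^ (1 - δ) :=
    ((tendsto_rpow_atTop (by linarith)).comp tendsto_natCast_atTop_atTop).eventually_ge_atTop 2
  obtain ⟨N₂, hN₂⟩ := eventually_atTop.1 (e1.and (e2.and (e3.and (eventually_ge_atTop (max Dℓ 1)))))
  refine ⟨ε₀ / 2, hε2, max N₁ N₂, ?_⟩
  intro n hn m E hsparse hexp hunsat ρ hρ
  obtain ⟨hpow, h3, hr2, hnD⟩ := hN₂ n (le_trans (le_max_right _ _) hn)
  have hnN₁ : N₁ ≤ n := le_trans (le_max_left _ _) hn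
  have hn1 : 1 ≤ n := le_trans (le_max_right _ _) hnD
  have hnD' : Dℓ ≤ n := le_trans (le_max_left _ _) hnD
  classical
  -- restriction and simulation
  set T := sumEncoding 1 E with hT
  obtain ⟨ρ', hρ', hlen, hW⟩ := exists_restricted_refutation (T := T) (N := n)
    (fun c hc l hl => fst_lt_of_mem_sumEncoding_one E hc hl) hρ
  obtain ⟨π, hπ, hsize⟩ := exists_proof_of_isResRefutation T ρ' (2 * n) hW hρ'
  -- the bounded-depth lower bound
  have hlb := hN₁ n hnN₁ m E hsparse hexp hunsat π hπ
  -- sizes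
  have hm : m ≤ (ℓ + 1) * n ^ ℓ :=
    card_rows_le_of_light_expansion E hr2 (mul_pos (by norm_num) (by exact_mod_cast hℓ)) hsparse hn1 hexp
  obtain ⟨hTl, hΦs⟩ := sizes_sumEncoding_le E hsparse
  obtain ⟨A, hA⟩ : ∃ A : ℕ, A = n ^ ℓ := ⟨_, rfl⟩
  have hnA : n ≤ A := by
    rw [hA]
    calc n = n ^ 1 := (pow_one n).symm
      _ ≤ n ^ ℓ := Nat.pow_le_pow_right hn1 hℓ
  have hq1 : 2 ^ ℓ * (3 * ℓ + 2) ≤ q := by rw [hq]; exact Nat.mul_le_mul_left _ (by omega)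
  have hq2 : 2 ^ ℓ ≤ q := by rw [hq]; exact Nat.le_mul_of_pos_right _ (by omega)
  have hΦs' : (PropForm.ofCNF T).size ≤ m * q + 1 :=
    hΦs.trans (by have := Nat.mul_le_mul_left m hq1; omega)
  have hTl' : T.length ≤ m * q := hTl.trans (Nat.mul_le_mul_left m hq2)
  have hmq : m * q ≤ (ℓ + 1) * A * q := by rw [hA]; exact Nat.mul_le_mul_right q hm
  obtain ⟨P, hP⟩ : ∃ P : ℕ, P = Cℓ * A := ⟨_, rfl⟩
  have hPeq : P = 2 * ((ℓ + 1) * A * q) + 9 * A := by rw [hP, hCℓ]; ring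
  have hA1 : 1 ≤ A := hn1.trans hnA
  have hK : (PropForm.ofCNF T).size + 2 * (2 * n) + T.length + 4 ≤ P := by
    rw [hPeq]; linarith [hΦs', hTl', hmq, hnA, hA1]
  have hq3 : 1 ≤ q := le_trans Nat.one_le_two_pow hq2
  have hx1 : 1 ≤ (ℓ + 1) * A * q := by
    have := Nat.mul_le_mul (Nat.mul_le_mul (show 1 ≤ ℓ + 1 by omega) hA1) hq3
    simpa using this
  have hLF : (PropForm.ofCNF T).size + 3 * (2 * n) + 3 ≤ P := by
    rw [hPeq]; linarith [hΦs', hmq, hnA, hA1, hx1]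
  have hP1 : 1 ≤ P := by rw [hPeq]; linarith [hA1]
  have hsize' : proofSize π ≤ (ρ.length + 1) * (Dℓ * n ^ (3 * ℓ)) := by
    rw [← hlen]
    refine hsize.trans ?_
    have h1 : 300 * ((PropForm.ofCNF T).size + 2 * (2 * n) + T.length + 4) ^ 2 ≤ 300 * P ^ 2 :=
      Nat.mul_le_mul_left _ (Nat.pow_le_pow_left hK 2)
    have h2 : 16 * ((PropForm.ofCNF T).size + 3 * (2 * n) + 3) + 60 ≤ 76 * P := by omega
    have hA3 : n ^ (3 * ℓ) = A ^ 3 := by rw [hA, ← pow_mul, mul_comm]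
    have h3 : Dℓ * n ^ (3 * ℓ) = 22800 * P ^ 3 := by
      rw [hA3, hDℓ, hP]; ring
    calc (ρ'.length + 1) * (300 * ((PropForm.ofCNF T).size + 2 * (2 * n) + T.length + 4) ^ 2) *
          (16 * ((PropForm.ofCNF T).size + 3 * (2 * n) + 3) + 60)
        ≤ (ρ'.length + 1) * (300 * P ^ 2) * (76 * P) :=
          Nat.mul_le_mul (Nat.mul_le_mul_left _ h1) h2
      _ = (ρ'.length + 1) * (22800 * P ^ 3) := by ring
      _ = (ρ'.length + 1) * (Dℓ * n ^ (3 * ℓ)) := by rw [h3]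
  -- the closing arithmetic: suppose `|ρ| < X = 2^{n^{ε₀/2}}`
  by_contra hlt
  push Not at hlt
  set X : ℝ := (2 : ℝ) ^ ((n : ℝ) ^ (ε₀ / 2)) with hX
  have hX1 : (1 : ℝ) ≤ X := Real.one_le_rpow one_le_two (by positivity)
  have hR2 : (ρ.length : ℝ) + 1 ≤ 2 * X := by linarith
  have hpoly : (Dℓ : ℝ) * (n : ℝ) ^ (3 * ℓ) < X := by
    have h1 : ((n : ℝ) ^ (3 * ℓ + 1) : ℝ) < X := by simpa using hpow
    have hnD'' : (Dℓ : ℝ) ≤ n := by exact_mod_cast hnD'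
    have hn0 : (0 : ℝ) ≤ (n : ℝ) ^ (3 * ℓ) := by positivity
    calc (Dℓ : ℝ) * (n : ℝ) ^ (3 * ℓ) ≤ n * (n : ℝ) ^ (3 * ℓ) := mul_le_mul_of_nonneg_right hnD'' hn0
      _ = (n : ℝ) ^ (3 * ℓ + 1) := by ring
      _ < X := h1
  have hchain : (2 : ℝ) ^ ((n : ℝ) ^ ε₀) < 2 * X * X := by
    calc (2 : ℝ) ^ ((n : ℝ) ^ ε₀) ≤ (proofSize π : ℝ) := hlb
      _ ≤ ((ρ.length : ℝ) + 1) * ((Dℓ : ℝ) * (n : ℝ) ^ (3 * ℓ)) := by exact_mod_cast hsize'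
      _ ≤ 2 * X * ((Dℓ : ℝ) * (n : ℝ) ^ (3 * ℓ)) := mul_le_mul_of_nonneg_right hR2 (by positivity)
      _ < 2 * X * X := mul_lt_mul_of_pos_left hpoly (by positivity)
  -- `2 X² = 2^{1 + 2 n^{ε₀/2}} ≤ 2^{n^{ε₀}}` as `n^{ε₀/2} ≥ 3`
  have hexp2 : 2 * X * X = (2 : ℝ) ^ (1 + 2 * (n : ℝ) ^ (ε₀ / 2)) := by
    rw [hX, Real.rpow_add two_pos, Real.rpow_one, two_mul ((n : ℝ) ^ (ε₀ / 2)),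
      Real.rpow_add two_pos]
    ring
  have hsq : (n : ℝ) ^ ε₀ = (n : ℝ) ^ (ε₀ / 2) * (n : ℝ) ^ (ε₀ / 2) := by
    rw [← Real.rpow_add_of_nonneg (Nat.cast_nonneg n) hε2.le hε2.le]; ring_nf
  have hle : 1 + 2 * (n : ℝ) ^ (ε₀ / 2) ≤ (n : ℝ) ^ ε₀ := by
    rw [hsq]; nlinarith
  have := Real.rpow_le_rpow_of_exponent_le one_le_two hle
  rw [← hexp2] at this
  linarith

end Summit.PneNP.PneNP.Theorems.ResSim
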